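import Mathlib.Analysis.Calculus.ContDiff.Bounds
import Mathlib.Analysis.Calculus.ContDiff.Operations
import Mathlib.Analysis.Calculus.MeanValue
import Mathlib.Topology.MetricSpace.Thickening
import Mathlib.Analysis.Normed.Module.FiniteDimension
import HarnessLib

/-!
# `C^k`-smallness is preserved under substitution into a smooth map

Analysis/Calculus support file (everything proved; theorems only, no definitions, no named facts).

Let `Φ : E × P → F` be `C^∞` on an open set `W`, let `K ⊆ E` be compact and `J₀ : E → P` smooth
near `K` with graph `{(y, J₀ y) : y ∈ K} ⊆ W`. **If `J` is `C^k`-close to `J₀` then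
`y ↦ Φ(y, J y)` is `C^k`-close to `y ↦ Φ(y, J₀ y)`, linearly**: for every `k` there are `δ > 0`
and `C` (depending only on `Φ`, `J₀`, `K`, `k`) such that, for every `J` smooth on an open set
`V` and every `S ⊆ V ∩ K`, the bounds `‖Dⁱ(J − J₀)(y)‖ ≤ η ≤ δ` (`i ≤ k`, `y ∈ S`) imply
`‖Dⁱ[Φ(·, J ·) − Φ(·, J₀ ·)](y)‖ ≤ C η` (`i ≤ k`, `y ∈ S`)
(`exists_norm_iteratedFDeriv_substitution_sub_le`). This is the elementary "continuity of the
substitution (Nemytskii) operator `J ↦ Φ(·, J)` from `C^k` to `C^k` at `J₀`, with a Lipschitz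
modulus", the calculus behind every statement of the form "if the metric `g` is `C^{k+1}`-close to
`g₀` then any tensor built algebraically from `g`, `∂g` (Christoffel symbols, unit normals, second
fundamental forms of a fixed hypersurface, …) is `C^k`-close to the one built from `g₀`" — e.g.
Li–Mei, arXiv:2005.01249, §2.2, p. 8: "The closeness to Schwarzschild metric implies that
`‖ḡ − ḡ_{m₀}‖_{C^k} + ‖k̄ − k̄_{m₀}‖_{C^k} ≤ C δ^{1/2}`".

Proof: induction on `k`. Order `0` is the mean value inequality in the fibre `P` (on the compact
`r`-neighbourhood of the graph inside `W`, Dieudonné (8.5.4)); the step differentiates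
`D[Φ(y, J y)] v = ∂₁Φ(y, J y) v + ∂₂Φ(y, J y) (DJ(y) v)` (chain rule, Dieudonné (8.9.1)) and applies
the induction hypothesis to `∂₁Φ`, `∂₂Φ` together with the Leibniz bound for the pairing
`(A, p) ↦ A p` (Mathlib's `norm_iteratedFDerivWithin_clm_apply`); the norm of the `(k+1)`-st
derivative is recovered from those of `y ↦ D[…](y) v`, `‖v‖ ≤ 1`
(`norm_iteratedFDeriv_succ_le_of_apply`).

* `norm_iteratedFDeriv_clm_apply_le_of_le` — Leibniz: on an open set, `‖DʲA(x)‖ ≤ a`,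
  `‖Dʲg(x)‖ ≤ b` (`j ≤ n`, `a ≥ 0`) give `‖Dⁿ[A(g)](x)‖ ≤ 2ⁿ a b`;
* `norm_iteratedFDeriv_clm_apply_const_le` — `‖Dⁿ[A(·) v](x)‖ ≤ ‖v‖ ‖DⁿA(x)‖`;
* `norm_iteratedFDeriv_succ_le_of_apply` — `‖Dⁿ⁺¹f(x)‖ ≤ c` if `‖Dⁿ[Df(·) v](x)‖ ≤ c ‖v‖` for
  all `v`;
* `exists_forall_norm_iteratedFDeriv_le_of_isCompact` — a function smooth on an open
  neighbourhood of a compact set has bounded derivatives of order `≤ n` there;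
* `exists_cthickening_graph_subset` — a compact graph inside an open set has a closed
  `r`-neighbourhood inside it;
* `exists_norm_iteratedFDeriv_substitution_sub_le` — the theorem.

## References

* J. Dieudonné, *Foundations of Modern Analysis* (1960), Ch. VIII, (8.5.4), (8.9.1), (8.12.10)
  (key `Dieudonne1960`).
* J. Li, H. Mei, *A construction of collapsing spacetimes in vacuum*, Comm. Math. Phys. 378 (2020),
  arXiv:2005.01249, §2.2 (key `LiMei2020`).
-/

noncomputable section

open Set Filter Metric Function Topology
open scoped ContDiff

namespace Literature.Analysis.Calculus

universe u

/-! ### Pointwise bookkeeping on open sets -/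

section Bookkeeping

variable {D X Y : Type*} [NormedAddCommGroup D] [NormedSpace ℝ D] [NormedAddCommGroup X]
  [NormedSpace ℝ X] [NormedAddCommGroup Y] [NormedSpace ℝ Y]

/-- On an open set, the iterated derivative of a difference of smooth functions is the difference
of the iterated derivatives. [folklore] -/
theorem iteratedFDeriv_sub_apply_of_isOpen {s : Set D} (hs : IsOpen s) {f g : D → X}
    (hf : ContDiffOn ℝ ∞ f s) (hg : ContDiffOn ℝ ∞ g s) {x : D} (hx : x ∈ s) (n : ℕ) :
    iteratedFDeriv ℝ n (fun z ↦ f z - g z) x = iteratedFDeriv ℝ n f x - iteratedFDeriv ℝ n g x := by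
  have hu : UniqueDiffOn ℝ s := hs.uniqueDiffOn
  rw [← iteratedFDerivWithin_of_isOpen n hs hx, ← iteratedFDerivWithin_of_isOpen n hs hx,
    ← iteratedFDerivWithin_of_isOpen n hs hx]
  exact iteratedFDerivWithin_sub_apply ((hf x hx).of_le (by exact_mod_cast le_top))
    ((hg x hx).of_le (by exact_mod_cast le_top)) hu hx

/-- On an open set, the iterated derivative of a sum of smooth functions is the sum of the
iterated derivatives. [folklore] -/
theorem iteratedFDeriv_add_apply_of_isOpen {s : Set D} (hs : IsOpen s) {f g : D → X}
    (hf : ContDiffOn ℝ ∞ f s) (hg : ContDiffOn ℝ ∞ g s) {x : D} (hx : x ∈ s) (n : ℕ) :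
    iteratedFDeriv ℝ n (fun z ↦ f z + g z) x = iteratedFDeriv ℝ n f x + iteratedFDeriv ℝ n g x := by
  have hu : UniqueDiffOn ℝ s := hs.uniqueDiffOn
  rw [← iteratedFDerivWithin_of_isOpen n hs hx, ← iteratedFDerivWithin_of_isOpen n hs hx,
    ← iteratedFDerivWithin_of_isOpen n hs hx]
  exact iteratedFDerivWithin_add_apply ((hf x hx).of_le (by exact_mod_cast le_top))
    ((hg x hx).of_le (by exact_mod_cast le_top)) hu hx

/-- **Leibniz bound for `A(g)` on an open set.** If `A : D → (X →L Y)` and `g : D → X` are smooth on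
the open set `s ∋ x` with `‖DʲA(x)‖ ≤ a` and `‖Dʲg(x)‖ ≤ b` for `j ≤ n`, then
`‖Dⁿ[z ↦ A z (g z)](x)‖ ≤ 2ⁿ a b` (Mathlib's `norm_iteratedFDerivWithin_clm_apply` and
`∑ (n choose j) = 2ⁿ`). Dieudonné (8.12.10). [folklore] -/
theorem norm_iteratedFDeriv_clm_apply_le_of_le {s : Set D} (hs : IsOpen s) {A : D → X →L[ℝ] Y}
    {g : D → X} (hA : ContDiffOn ℝ ∞ A s) (hg : ContDiffOn ℝ ∞ g s) {x : D} (hx : x ∈ s) {n : ℕ}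
    {a b : ℝ} (ha : 0 ≤ a) (hAa : ∀ j ≤ n, ‖iteratedFDeriv ℝ j A x‖ ≤ a)
    (hgb : ∀ j ≤ n, ‖iteratedFDeriv ℝ j g x‖ ≤ b) :
    ‖iteratedFDeriv ℝ n (fun z ↦ A z (g z)) x‖ ≤ 2 ^ n * a * b := by
  have hu : UniqueDiffOn ℝ s := hs.uniqueDiffOn
  have h := norm_iteratedFDerivWithin_clm_apply (N := ∞) hA hg hu hx (n := n)
    (by exact_mod_cast le_top)
  rw [iteratedFDerivWithin_of_isOpen n hs hx] at h
  refine h.trans ?_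
  have hterm : ∀ i ∈ Finset.range (n + 1), (n.choose i : ℝ) * ‖iteratedFDerivWithin ℝ i A s x‖ *
      ‖iteratedFDerivWithin ℝ (n - i) g s x‖ ≤ (n.choose i : ℝ) * (a * b) := by
    intro i hi
    have hi' : i ≤ n := Nat.lt_succ_iff.mp (Finset.mem_range.mp hi)
    rw [iteratedFDerivWithin_of_isOpen i hs hx, iteratedFDerivWithin_of_isOpen (n - i) hs hx,
      mul_assoc]
    refine mul_le_mul_of_nonneg_left ?_ (Nat.cast_nonneg _)
    exact mul_le_mul (hAa i hi') (hgb (n - i) (Nat.sub_le n i)) (norm_nonneg _) ha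
  refine (Finset.sum_le_sum hterm).trans ?_
  have hchoose : ∑ i ∈ Finset.range (n + 1), (n.choose i : ℝ) = 2 ^ n := by
    exact_mod_cast Nat.sum_range_choose n
  rw [← Finset.sum_mul, hchoose]
  exact le_of_eq (by ring)

/-- `‖Dⁿ[z ↦ A z v](x)‖ ≤ ‖v‖ ‖DⁿA(x)‖` for `A` smooth on an open set `s ∋ x` (Mathlib's
`norm_iteratedFDerivWithin_clm_apply_const`). [folklore] -/
theorem norm_iteratedFDeriv_clm_apply_const_le {s : Set D} (hs : IsOpen s) {A : D → X →L[ℝ] Y}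
    (hA : ContDiffOn ℝ ∞ A s) {x : D} (hx : x ∈ s) (n : ℕ) (v : X) :
    ‖iteratedFDeriv ℝ n (fun z ↦ A z v) x‖ ≤ ‖v‖ * ‖iteratedFDeriv ℝ n A x‖ := by
  have hu : UniqueDiffOn ℝ s := hs.uniqueDiffOn
  have h := norm_iteratedFDerivWithin_clm_apply_const (N := ∞) (c := v) (hA x hx) hu hx (n := n)
    (by exact_mod_cast le_top)
  rwa [iteratedFDerivWithin_of_isOpen n hs hx, iteratedFDerivWithin_of_isOpen n hs hx] at h

/-- **The norm of `Dⁿ⁺¹f` from the applied derivatives**: if `f` is smooth on an open set `s ∋ x`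
and `‖Dⁿ[z ↦ Df(z) v](x)‖ ≤ c ‖v‖` for every `v`, then `‖Dⁿ⁺¹f(x)‖ ≤ c`
(`Dⁿ⁺¹f(x)(m, v) = Dⁿ[Df(·) v](x)(m)`, Mathlib's `iteratedFDerivWithin_clm_apply_const_apply`).
[folklore] -/
theorem norm_iteratedFDeriv_succ_le_of_apply {s : Set D} (hs : IsOpen s) {f : D → X}
    (hf : ContDiffOn ℝ ∞ f s) {x : D} (hx : x ∈ s) {n : ℕ} {c : ℝ} (hc : 0 ≤ c)
    (h : ∀ v : D, ‖iteratedFDeriv ℝ n (fun z ↦ fderiv ℝ f z v) x‖ ≤ c * ‖v‖) :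
    ‖iteratedFDeriv ℝ (n + 1) f x‖ ≤ c := by
  have hu : UniqueDiffOn ℝ s := hs.uniqueDiffOn
  have hDf : ContDiffOn ℝ ∞ (fun z ↦ fderiv ℝ f z) s := hf.fderiv_of_isOpen hs (by simp)
  rw [← norm_iteratedFDeriv_fderiv]
  refine ContinuousMultilinearMap.opNorm_le_bound hc fun m ↦ ?_
  refine ContinuousLinearMap.opNorm_le_bound _ (by positivity) fun v ↦ ?_
  have happ : iteratedFDeriv ℝ n (fun z ↦ fderiv ℝ f z v) x m = iteratedFDeriv ℝ n (fderiv ℝ f) x m v := by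
    rw [← iteratedFDerivWithin_of_isOpen n hs hx, ← iteratedFDerivWithin_of_isOpen n hs hx]
    exact iteratedFDerivWithin_clm_apply_const_apply hu hDf (by exact_mod_cast le_top) hx
  rw [← happ]
  calc ‖iteratedFDeriv ℝ n (fun z ↦ fderiv ℝ f z v) x m‖
      ≤ ‖iteratedFDeriv ℝ n (fun z ↦ fderiv ℝ f z v) x‖ * ∏ i, ‖m i‖ :=
        ContinuousMultilinearMap.le_opNorm _ _
    _ ≤ c * ‖v‖ * ∏ i, ‖m i‖ := by gcongr; exact h v
    _ = c * (∏ i, ‖m i‖) * ‖v‖ := by ring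

/-- **A function smooth on an open neighbourhood of a compact set has bounded derivatives of order
`≤ n` on it** (continuity of `Dʲf` on the open set, compactness). [folklore] -/
theorem exists_forall_norm_iteratedFDeriv_le_of_isCompact {s : Set D} (hs : IsOpen s) {f : D → X}
    (hf : ContDiffOn ℝ ∞ f s) {K : Set D} (hK : IsCompact K) (hKs : K ⊆ s) (n : ℕ) :
    ∃ B : ℝ, 0 ≤ B ∧ ∀ j ≤ n, ∀ y ∈ K, ‖iteratedFDeriv ℝ j f y‖ ≤ B := by
  have hcont : ∀ j : ℕ, ContinuousOn (fun y ↦ iteratedFDeriv ℝ j f y) K := fun j ↦ by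
    refine ContinuousOn.congr ((hf.continuousOn_iteratedFDerivWithin (m := j)
      (by exact_mod_cast le_top) hs.uniqueDiffOn).mono hKs) fun y hy ↦ ?_
    exact (iteratedFDerivWithin_of_isOpen j hs (hKs hy)).symm
  induction n with
  | zero =>
    obtain ⟨B, hB⟩ := hK.exists_bound_of_continuousOn (hcont 0)
    refine ⟨max B 0, le_max_right _ _, fun j hj y hy ↦ ?_⟩
    rw [Nat.le_zero.mp hj]
    exact (hB y hy).trans (le_max_left _ _)
  | succ n ih =>
    obtain ⟨B, hB0, hB⟩ := ih
    obtain ⟨B', hB'⟩ := hK.exists_bound_of_continuousOn (hcont (n + 1))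
    refine ⟨max B B', le_max_of_le_left hB0, fun j hj y hy ↦ ?_⟩
    rcases Nat.of_le_succ hj with h | h
    · exact (hB j h y hy).trans (le_max_left _ _)
    · rw [h]; exact (hB' y hy).trans (le_max_right _ _)

end Bookkeeping

/-! ### The substitution estimate -/

section Substitution

variable {E P : Type u} [NormedAddCommGroup E] [NormedSpace ℝ E] [NormedAddCommGroup P]
  [NormedSpace ℝ P]

/-- The chain rule for a substitution: `D[Φ(·, J ·)](z) = ∂₁Φ(z, J z) + ∂₂Φ(z, J z) ∘ DJ(z)`, with
`∂₁Φ = DΦ ∘ inl`, `∂₂Φ = DΦ ∘ inr`, in applied form. Dieudonné (8.9.1). [folklore] -/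
theorem fderiv_substitution_apply {F : Type u} [NormedAddCommGroup F] [NormedSpace ℝ F]
    {Φ : E × P → F} {J : E → P} {z : E} (hΦ : DifferentiableAt ℝ Φ (z, J z))
    (hJ : DifferentiableAt ℝ J z) (v : E) :
    fderiv ℝ (fun w ↦ Φ (w, J w)) z v =
      (fderiv ℝ Φ (z, J z)).comp (ContinuousLinearMap.inl ℝ E P) v +
        (fderiv ℝ Φ (z, J z)).comp (ContinuousLinearMap.inr ℝ E P) (fderiv ℝ J z v) := by
  have h : HasFDerivAt (fun w ↦ Φ (w, J w))
      ((fderiv ℝ Φ (z, J z)).comp ((ContinuousLinearMap.id ℝ E).prod (fderiv ℝ J z))) z :=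
    hΦ.hasFDerivAt.comp z (hasFDerivAt_id z |>.prodMk hJ.hasFDerivAt)
  rw [h.fderiv]
  simp only [ContinuousLinearMap.coe_comp, comp_apply, ContinuousLinearMap.prod_apply,
    ContinuousLinearMap.coe_id', id_eq, ContinuousLinearMap.inl_apply,
    ContinuousLinearMap.inr_apply]
  rw [← map_add]
  simp

variable [FiniteDimensional ℝ E] [FiniteDimensional ℝ P]

/-- **A compact graph inside an open set has a closed neighbourhood inside it**: if `J₀` is
continuous on `K` (compact) with `(y, J₀ y) ∈ W` (`W` open) for `y ∈ K`, there is `r > 0` and a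
compact `N ⊆ W` such that `(y, p) ∈ N` whenever `y ∈ K` and `‖p − J₀ y‖ ≤ r`. [folklore] -/
theorem exists_cthickening_graph_subset {K : Set E} (hK : IsCompact K) {J₀ : E → P}
    (hJ₀ : ContinuousOn J₀ K) {W : Set (E × P)} (hW : IsOpen W) (hgraph : ∀ y ∈ K, (y, J₀ y) ∈ W) :
    ∃ r > 0, ∃ N : Set (E × P), IsCompact N ∧ N ⊆ W ∧
      ∀ y ∈ K, ∀ p : P, ‖p - J₀ y‖ ≤ r → (y, p) ∈ N := by
  set Γ : Set (E × P) := (fun y ↦ (y, J₀ y)) '' K with hΓ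
  have hΓc : IsCompact Γ := hK.image_of_continuousOn (continuousOn_id.prodMk hJ₀)
  have hΓW : Γ ⊆ W := by
    rintro _ ⟨y, hy, rfl⟩
    exact hgraph y hy
  obtain ⟨r, hr, hrW⟩ := hΓc.exists_cthickening_subset_open hW hΓW
  refine ⟨r, hr, cthickening r Γ, hΓc.cthickening, hrW, fun y hy p hp ↦ ?_⟩
  refine mem_cthickening_of_dist_le (y, p) (y, J₀ y) r Γ ⟨y, hy, rfl⟩ ?_
  rw [Prod.dist_eq, dist_self, dist_eq_norm]
  exact max_le hr.le hp

/-- **Substitution into a smooth map is locally Lipschitz from `C^k` to `C^k`.** Let `Φ : E × P → F`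
be `C^∞` on the open set `W`, `K ⊆ E` compact, `J₀` smooth on an open `V₀ ⊇ K` with
`(y, J₀ y) ∈ W` for `y ∈ K`. Then for every `k` there are `δ > 0` and `C ≥ 0` such that: for every
`J` smooth on an open set `V`, every `S ⊆ V ∩ K` and every `0 ≤ η ≤ δ`, if
`‖Dⁱ(J − J₀)(y)‖ ≤ η` for all `i ≤ k`, `y ∈ S`, then
`‖Dⁱ[Φ(·, J ·) − Φ(·, J₀ ·)](y)‖ ≤ C η` for all `i ≤ k`, `y ∈ S`.
Dieudonné 1960, (8.5.4) (mean value inequality, order `0`), (8.9.1) and (8.12.10) (chain and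
Leibniz rules, induction on `k`). [cite: Dieudonne1960, (8.5.4), (8.9.1), (8.12.10)] -/
theorem exists_norm_iteratedFDeriv_substitution_sub_le {K : Set E} (hK : IsCompact K) {V₀ : Set E}
    (hV₀ : IsOpen V₀) (hKV₀ : K ⊆ V₀) {J₀ : E → P} (hJ₀ : ContDiffOn ℝ ∞ J₀ V₀) (k : ℕ) :
    ∀ {F : Type u} [NormedAddCommGroup F] [NormedSpace ℝ F] {Φ : E × P → F} {W : Set (E × P)},
      IsOpen W → ContDiffOn ℝ ∞ Φ W → (∀ y ∈ K, (y, J₀ y) ∈ W) →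
      ∃ δ > 0, ∃ C : ℝ, 0 ≤ C ∧ ∀ (J : E → P) (V S : Set E) (η : ℝ), IsOpen V → S ⊆ V → S ⊆ K →
        ContDiffOn ℝ ∞ J V → 0 ≤ η → η ≤ δ →
        (∀ i ≤ k, ∀ y ∈ S, ‖iteratedFDeriv ℝ i (fun z ↦ J z - J₀ z) y‖ ≤ η) →
        ∀ i ≤ k, ∀ y ∈ S, ‖iteratedFDeriv ℝ i (fun z ↦ Φ (z, J z) - Φ (z, J₀ z)) y‖ ≤ C * η := by
  induction k with
  | zero =>
    intro F _ _ Φ W hW hΦ hgraph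
    obtain ⟨r, hr, N, hNc, hNW, hN⟩ := exists_cthickening_graph_subset hK
      (hJ₀.continuousOn.mono hKV₀) hW hgraph
    -- bound on `DΦ` on the compact neighbourhood `N`
    have hDc : ContinuousOn (fun q ↦ fderiv ℝ Φ q) N :=
      (hΦ.continuousOn_fderiv_of_isOpen hW (by exact_mod_cast le_top)).mono hNW
    obtain ⟨L, hL⟩ := hNc.exists_bound_of_continuousOn hDc
    refine ⟨r, hr, max L 0, le_max_right _ _, ?_⟩
    intro J V S η hV hSV hSK hJ hη0 hηr hyp i hi y hy
    obtain rfl : i = 0 := Nat.le_zero.mp hi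
    rw [norm_iteratedFDeriv_zero]
    have hJy : ‖J y - J₀ y‖ ≤ η := by
      have := hyp 0 le_rfl y hy
      rwa [norm_iteratedFDeriv_zero] at this
    -- mean value inequality in the fibre on the closed ball of radius `r` about `J₀ y`
    have hball : ∀ p ∈ closedBall (J₀ y) r, (y, p) ∈ N := fun p hp ↦
      hN y (hSK hy) p (by rwa [mem_closedBall, dist_eq_norm] at hp)
    have hderiv : ∀ p ∈ closedBall (J₀ y) r,
        HasFDerivWithinAt (fun p ↦ Φ (y, p))
          ((fderiv ℝ Φ (y, p)).comp (ContinuousLinearMap.inr ℝ E P)) (closedBall (J₀ y) r) p := by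
      intro p hp
      have hd : DifferentiableAt ℝ Φ (y, p) :=
        (hΦ.differentiableOn (by simp)).differentiableAt (hW.mem_nhds (hNW (hball p hp)))
      exact (hd.hasFDerivAt.comp p (hasFDerivAt_prodMk_right (𝕜 := ℝ) y p)).hasFDerivWithinAt
    have hbound : ∀ p ∈ closedBall (J₀ y) r,
        ‖(fderiv ℝ Φ (y, p)).comp (ContinuousLinearMap.inr ℝ E P)‖ ≤ max L 0 := by
      intro p hp
      calc ‖(fderiv ℝ Φ (y, p)).comp (ContinuousLinearMap.inr ℝ E P)‖
          ≤ ‖fderiv ℝ Φ (y, p)‖ * ‖ContinuousLinearMap.inr ℝ E P‖ :=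
            ContinuousLinearMap.opNorm_comp_le _ _
        _ ≤ max L 0 * 1 := by
            apply mul_le_mul ((hL _ (hball p hp)).trans (le_max_left _ _))
              (ContinuousLinearMap.norm_inr_le_one ℝ E P) (norm_nonneg _) (le_max_right _ _)
        _ = max L 0 := mul_one _
    have hmem₀ : J₀ y ∈ closedBall (J₀ y) r := mem_closedBall_self hr.le
    have hmem : J y ∈ closedBall (J₀ y) r := by
      rw [mem_closedBall, dist_eq_norm]; exact hJy.trans hηr
    have hmv := (convex_closedBall (J₀ y) r).norm_image_sub_le_of_norm_hasFDerivWithin_le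
      hderiv hbound hmem₀ hmem
    calc ‖Φ (y, J y) - Φ (y, J₀ y)‖ ≤ max L 0 * ‖J y - J₀ y‖ := hmv
      _ ≤ max L 0 * η := mul_le_mul_of_nonneg_left hJy (le_max_right _ _)
  | succ k ih =>
    intro F _ _ Φ W hW hΦ hgraph
    -- room inside `W`
    obtain ⟨r, hr, N, -, hNW, hN⟩ := exists_cthickening_graph_subset hK
      (hJ₀.continuousOn.mono hKV₀) hW hgraph
    -- the partial derivatives of `Φ`, smooth on `W`
    set Φ₁ : E × P → (E →L[ℝ] F) :=
      fun q ↦ (fderiv ℝ Φ q).comp (ContinuousLinearMap.inl ℝ E P) with hΦ₁_def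
    set Φ₂ : E × P → (P →L[ℝ] F) :=
      fun q ↦ (fderiv ℝ Φ q).comp (ContinuousLinearMap.inr ℝ E P) with hΦ₂_def
    have hDΦ : ContDiffOn ℝ ∞ (fun q ↦ fderiv ℝ Φ q) W := hΦ.fderiv_of_isOpen hW (by simp)
    have hΦ₁ : ContDiffOn ℝ ∞ Φ₁ W := hDΦ.clm_comp contDiffOn_const
    have hΦ₂ : ContDiffOn ℝ ∞ Φ₂ W := hDΦ.clm_comp contDiffOn_const
    -- induction hypotheses for `Φ`, `Φ₁`, `Φ₂`
    obtain ⟨δ₀, hδ₀, C₀, hC₀, H₀⟩ := ih hW hΦ hgraph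
    obtain ⟨δ₁, hδ₁, C₁, hC₁, H₁⟩ := ih hW hΦ₁ hgraph
    obtain ⟨δ₂, hδ₂, C₂, hC₂, H₂⟩ := ih hW hΦ₂ hgraph
    -- bounds for the fixed smooth functions `DJ₀` and `Φ₂(·, J₀ ·)` on `K`
    obtain ⟨B₁, hB₁0, hB₁⟩ := exists_forall_norm_iteratedFDeriv_le_of_isCompact hV₀
      (hJ₀.fderiv_of_isOpen hV₀ (by simp)) hK hKV₀ k
    set V₂ : Set E := V₀ ∩ (fun z ↦ (z, J₀ z)) ⁻¹' W with hV₂_def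
    have hV₂ : IsOpen V₂ :=
      (continuousOn_id.prodMk hJ₀.continuousOn).isOpen_inter_preimage hV₀ hW
    have hKV₂ : K ⊆ V₂ := fun y hy ↦ ⟨hKV₀ hy, hgraph y hy⟩
    have hG₀ : ContDiffOn ℝ ∞ (fun z ↦ Φ₂ (z, J₀ z)) V₂ :=
      hΦ₂.comp (contDiffOn_id.prodMk (hJ₀.mono inter_subset_left)) fun z hz ↦ hz.2
    obtain ⟨B₂, hB₂0, hB₂⟩ := exists_forall_norm_iteratedFDeriv_le_of_isCompact hV₂ hG₀ hK hKV₂ k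
    -- the constants
    refine ⟨min (min δ₀ δ₁) (min δ₂ (min r 1)), by positivity,
      C₀ + (C₁ + 2 ^ k * C₂ * (B₁ + 1) + 2 ^ k * B₂), by positivity, ?_⟩
    intro J V S η hV hSV hSK hJ hη0 hηδ hyp i hi y hy
    have hηδ₀ : η ≤ δ₀ := hηδ.trans ((min_le_left _ _).trans (min_le_left _ _))
    have hηδ₁ : η ≤ δ₁ := hηδ.trans ((min_le_left _ _).trans (min_le_right _ _))
    have hηδ₂ : η ≤ δ₂ := hηδ.trans ((min_le_right _ _).trans (min_le_left _ _))
    have hηr : η ≤ r :=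
      hηδ.trans ((min_le_right _ _).trans ((min_le_right _ _).trans (min_le_left _ _)))
    have hη1 : η ≤ 1 :=
      hηδ.trans ((min_le_right _ _).trans ((min_le_right _ _).trans (min_le_right _ _)))
    have hypk : ∀ i ≤ k, ∀ y ∈ S, ‖iteratedFDeriv ℝ i (fun z ↦ J z - J₀ z) y‖ ≤ η :=
      fun i hi y hy ↦ hyp i (hi.trans k.le_succ) y hy
    have hCη : C₀ * η ≤ (C₀ + (C₁ + 2 ^ k * C₂ * (B₁ + 1) + 2 ^ k * B₂)) * η :=
      mul_le_mul_of_nonneg_right (le_add_of_nonneg_right (by positivity)) hη0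
    -- orders `≤ k`: the induction hypothesis for `Φ` itself
    rcases Nat.of_le_succ hi with hik | rfl
    · exact (H₀ J V S η hV hSV hSK hJ hη0 hηδ₀ hypk i hik y hy).trans hCη
    -- order `k + 1`: differentiate once, on the open set where everything is smooth
    set V' : Set E := (V ∩ V₀) ∩ ((fun z ↦ (z, J z)) ⁻¹' W ∩ (fun z ↦ (z, J₀ z)) ⁻¹' W)
      with hV'_def
    have hVV₀ : IsOpen (V ∩ V₀) := hV.inter hV₀
    have hV' : IsOpen V' := by
      have h1 : IsOpen ((V ∩ V₀) ∩ (fun z ↦ (z, J z)) ⁻¹' W) :=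
        (continuousOn_id.prodMk (hJ.continuousOn.mono inter_subset_left)).isOpen_inter_preimage
          hVV₀ hW
      have h2 : IsOpen ((V ∩ V₀) ∩ (fun z ↦ (z, J₀ z)) ⁻¹' W) :=
        (continuousOn_id.prodMk (hJ₀.continuousOn.mono inter_subset_right)).isOpen_inter_preimage
          hVV₀ hW
      have : V' = ((V ∩ V₀) ∩ (fun z ↦ (z, J z)) ⁻¹' W) ∩ ((V ∩ V₀) ∩ (fun z ↦ (z, J₀ z)) ⁻¹' W) := by
        rw [hV'_def]; ext z; simp only [mem_inter_iff, mem_preimage]; tauto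
      rw [this]
      exact h1.inter h2
    have hJyW : (y, J y) ∈ W := by
      refine hNW (hN y (hSK hy) (J y) ?_)
      have := hyp 0 (Nat.zero_le _) y hy
      rw [norm_iteratedFDeriv_zero] at this
      exact this.trans hηr
    have hyV' : y ∈ V' := ⟨⟨hSV hy, hKV₀ (hSK hy)⟩, hJyW, hgraph y (hSK hy)⟩
    -- smoothness on `V'`
    have hJ' : ContDiffOn ℝ ∞ J V' := hJ.mono fun z hz ↦ hz.1.1
    have hJ₀' : ContDiffOn ℝ ∞ J₀ V' := hJ₀.mono fun z hz ↦ hz.1.2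
    have hJJ₀ : ContDiffOn ℝ ∞ (fun z ↦ J z - J₀ z) V' := hJ'.sub hJ₀'
    have hpair : ContDiffOn ℝ ∞ (fun z ↦ (z, J z)) V' := contDiffOn_id.prodMk hJ'
    have hpair₀ : ContDiffOn ℝ ∞ (fun z ↦ (z, J₀ z)) V' := contDiffOn_id.prodMk hJ₀'
    have hmaps : MapsTo (fun z ↦ (z, J z)) V' W := fun z hz ↦ hz.2.1
    have hmaps₀ : MapsTo (fun z ↦ (z, J₀ z)) V' W := fun z hz ↦ hz.2.2
    have hΨ : ContDiffOn ℝ ∞ (fun z ↦ Φ (z, J z)) V' := hΦ.comp hpair hmaps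
    have hΨ₀ : ContDiffOn ℝ ∞ (fun z ↦ Φ (z, J₀ z)) V' := hΦ.comp hpair₀ hmaps₀
    have hΔ : ContDiffOn ℝ ∞ (fun z ↦ Φ (z, J z) - Φ (z, J₀ z)) V' := hΨ.sub hΨ₀
    have hA₁ : ContDiffOn ℝ ∞ (fun z ↦ Φ₁ (z, J z) - Φ₁ (z, J₀ z)) V' :=
      (hΦ₁.comp hpair hmaps).sub (hΦ₁.comp hpair₀ hmaps₀)
    have hA₂ : ContDiffOn ℝ ∞ (fun z ↦ Φ₂ (z, J z) - Φ₂ (z, J₀ z)) V' :=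
      (hΦ₂.comp hpair hmaps).sub (hΦ₂.comp hpair₀ hmaps₀)
    have hA₂₀ : ContDiffOn ℝ ∞ (fun z ↦ Φ₂ (z, J₀ z)) V' := hΦ₂.comp hpair₀ hmaps₀
    have hDJ : ContDiffOn ℝ ∞ (fun z ↦ fderiv ℝ J z) V' := hJ'.fderiv_of_isOpen hV' (by simp)
    have hDJJ₀ : ContDiffOn ℝ ∞ (fun z ↦ fderiv ℝ (fun w ↦ J w - J₀ w) z) V' :=
      hJJ₀.fderiv_of_isOpen hV' (by simp)
    -- differentiability at the points of `V'`
    have hdiff : ∀ z ∈ V', DifferentiableAt ℝ Φ (z, J z) ∧ DifferentiableAt ℝ Φ (z, J₀ z) ∧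
        DifferentiableAt ℝ J z ∧ DifferentiableAt ℝ J₀ z := fun z hz ↦
      ⟨(hΦ.differentiableOn (by simp)).differentiableAt (hW.mem_nhds hz.2.1),
        (hΦ.differentiableOn (by simp)).differentiableAt (hW.mem_nhds hz.2.2),
        (hJ'.differentiableOn (by simp)).differentiableAt (hV'.mem_nhds hz),
        (hJ₀'.differentiableOn (by simp)).differentiableAt (hV'.mem_nhds hz)⟩
    -- reduce to the applied derivatives `z ↦ D[…](z) v`
    refine norm_iteratedFDeriv_succ_le_of_apply hV' hΔ hyV' (by positivity) fun v ↦ ?_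
    -- the three terms of `D[Φ(·, J ·) − Φ(·, J₀ ·)] v`
    set T₁ : E → F := fun z ↦ (Φ₁ (z, J z) - Φ₁ (z, J₀ z)) v with hT₁_def
    set T₂ : E → F := fun z ↦ (Φ₂ (z, J z) - Φ₂ (z, J₀ z)) (fderiv ℝ J z v) with hT₂_def
    set T₃ : E → F := fun z ↦ (Φ₂ (z, J₀ z)) (fderiv ℝ (fun w ↦ J w - J₀ w) z v) with hT₃_def
    have hg₂ : ContDiffOn ℝ ∞ (fun z ↦ fderiv ℝ J z v) V' := hDJ.clm_apply contDiffOn_const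
    have hg₃ : ContDiffOn ℝ ∞ (fun z ↦ fderiv ℝ (fun w ↦ J w - J₀ w) z v) V' :=
      hDJJ₀.clm_apply contDiffOn_const
    have hT₁ : ContDiffOn ℝ ∞ T₁ V' := hA₁.clm_apply contDiffOn_const
    have hT₂ : ContDiffOn ℝ ∞ T₂ V' := hA₂.clm_apply hg₂
    have hT₃ : ContDiffOn ℝ ∞ T₃ V' := hA₂₀.clm_apply hg₃
    have hderiv : (fun z ↦ fderiv ℝ (fun w ↦ Φ (w, J w) - Φ (w, J₀ w)) z v) =ᶠ[𝓝 y]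
        fun z ↦ T₁ z + (T₂ z + T₃ z) := by
      filter_upwards [hV'.mem_nhds hyV'] with z hz
      obtain ⟨hdΦ, hdΦ₀, hdJ, hdJ₀⟩ := hdiff z hz
      have hdΨ : DifferentiableAt ℝ (fun w ↦ Φ (w, J w)) z :=
        (hΨ.differentiableOn (by simp)).differentiableAt (hV'.mem_nhds hz)
      have hdΨ₀ : DifferentiableAt ℝ (fun w ↦ Φ (w, J₀ w)) z :=
        (hΨ₀.differentiableOn (by simp)).differentiableAt (hV'.mem_nhds hz)
      rw [fderiv_fun_sub hdΨ hdΨ₀]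
      simp only [hT₁_def, hT₂_def, hT₃_def, hΦ₁_def, hΦ₂_def, sub_apply,
        fderiv_substitution_apply hdΦ hdJ, fderiv_substitution_apply hdΦ₀ hdJ₀,
        fderiv_fun_sub hdJ hdJ₀, map_sub]
      abel
    rw [(hderiv.iteratedFDeriv ℝ k).eq_of_nhds,
      iteratedFDeriv_add_apply_of_isOpen hV' hT₁ (hT₂.add hT₃) hyV',
      iteratedFDeriv_add_apply_of_isOpen hV' hT₂ hT₃ hyV']
    -- bound for `T₁`: induction hypothesis for `∂₁Φ`
    have hb₁ : ‖iteratedFDeriv ℝ k T₁ y‖ ≤ C₁ * η * ‖v‖ := by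
      refine (norm_iteratedFDeriv_clm_apply_const_le hV' hA₁ hyV' k v).trans ?_
      rw [mul_comm]
      exact mul_le_mul_of_nonneg_right (H₁ J V S η hV hSV hSK hJ hη0 hηδ₁ hypk k le_rfl y hy)
        (norm_nonneg _)
    -- bound for `T₂`: induction hypothesis for `∂₂Φ` and Leibniz
    have hfa₂ : ∀ j ≤ k, ‖iteratedFDeriv ℝ j (fun z ↦ Φ₂ (z, J z) - Φ₂ (z, J₀ z)) y‖ ≤ C₂ * η :=
      fun j hj ↦ H₂ J V S η hV hSV hSK hJ hη0 hηδ₂ hypk j hj y hy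
    have hgb₂ : ∀ j ≤ k, ‖iteratedFDeriv ℝ j (fun z ↦ fderiv ℝ J z v) y‖ ≤ (B₁ + 1) * ‖v‖ := by
      intro j hj
      refine (norm_iteratedFDeriv_clm_apply_const_le hV' hDJ hyV' j v).trans ?_
      rw [mul_comm]
      refine mul_le_mul_of_nonneg_right ?_ (norm_nonneg _)
      have hsplit : (fun z ↦ fderiv ℝ J z) =ᶠ[𝓝 y]
          fun z ↦ fderiv ℝ J₀ z + fderiv ℝ (fun w ↦ J w - J₀ w) z := by
        filter_upwards [hV'.mem_nhds hyV'] with z hz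
        obtain ⟨-, -, hdJ, hdJ₀⟩ := hdiff z hz
        rw [fderiv_fun_sub hdJ hdJ₀]; abel
      rw [(hsplit.iteratedFDeriv ℝ j).eq_of_nhds,
        iteratedFDeriv_add_apply_of_isOpen hV' (hJ₀'.fderiv_of_isOpen hV' (by simp)) hDJJ₀ hyV']
      refine (norm_add_le _ _).trans (add_le_add (hB₁ j hj y (hSK hy)) ?_)
      rw [norm_iteratedFDeriv_fderiv]
      exact (hyp (j + 1) (Nat.succ_le_succ hj) y hy).trans hη1
    have hb₂ : ‖iteratedFDeriv ℝ k T₂ y‖ ≤ 2 ^ k * (C₂ * η) * ((B₁ + 1) * ‖v‖) :=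
      norm_iteratedFDeriv_clm_apply_le_of_le hV' hA₂ hg₂ hyV' (by positivity) hfa₂ hgb₂
    -- bound for `T₃`: the fixed function `Φ₂(·, J₀ ·)` and Leibniz
    have hfa₃ : ∀ j ≤ k, ‖iteratedFDeriv ℝ j (fun z ↦ Φ₂ (z, J₀ z)) y‖ ≤ B₂ :=
      fun j hj ↦ hB₂ j hj y (hSK hy)
    have hgb₃ : ∀ j ≤ k, ‖iteratedFDeriv ℝ j (fun z ↦ fderiv ℝ (fun w ↦ J w - J₀ w) z v) y‖ ≤
        η * ‖v‖ := by
      intro j hj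
      refine (norm_iteratedFDeriv_clm_apply_const_le hV' hDJJ₀ hyV' j v).trans ?_
      rw [mul_comm, norm_iteratedFDeriv_fderiv]
      exact mul_le_mul_of_nonneg_right (hyp (j + 1) (Nat.succ_le_succ hj) y hy) (norm_nonneg _)
    have hb₃ : ‖iteratedFDeriv ℝ k T₃ y‖ ≤ 2 ^ k * B₂ * (η * ‖v‖) :=
      norm_iteratedFDeriv_clm_apply_le_of_le hV' hA₂₀ hg₃ hyV' hB₂0 hfa₃ hgb₃
    -- assemble
    calc ‖iteratedFDeriv ℝ k T₁ y + (iteratedFDeriv ℝ k T₂ y + iteratedFDeriv ℝ k T₃ y)‖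
        ≤ ‖iteratedFDeriv ℝ k T₁ y‖ + (‖iteratedFDeriv ℝ k T₂ y‖ + ‖iteratedFDeriv ℝ k T₃ y‖) :=
          (norm_add_le _ _).trans (add_le_add le_rfl (norm_add_le _ _))
      _ ≤ C₁ * η * ‖v‖ + (2 ^ k * (C₂ * η) * ((B₁ + 1) * ‖v‖) + 2 ^ k * B₂ * (η * ‖v‖)) :=
          add_le_add hb₁ (add_le_add hb₂ hb₃)
      _ = (C₁ + 2 ^ k * C₂ * (B₁ + 1) + 2 ^ k * B₂) * η * ‖v‖ := by ring
      _ ≤ (C₀ + (C₁ + 2 ^ k * C₂ * (B₁ + 1) + 2 ^ k * B₂)) * η * ‖v‖ :=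
          mul_le_mul_of_nonneg_right (mul_le_mul_of_nonneg_right (le_add_of_nonneg_left hC₀) hη0)
            (norm_nonneg _)

end Substitution

end Literature.Analysis.Calculus

end
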